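import Summits.QuantumFields.BalabanUV.T4Continuum.Support.GradedWellSubContourRows

/-!
# T⁴ programme, spine node NE2 (U1a), sub-row Δ1 — THE GRADED WELL, supplier brick «GW-V» file B4: THE PER-UNIT-ROW BOUND
# (`n^d·|(Q_n A)(z,μ)|² ≤ ½·Σ_{ω ∈ Tset} w_ω²|(Q A)_ω|²` when both endpoint blocks lie in layers `≥ 1`: two-level Jensen with coefficients `L^{−2lo} + L^{−2hi} ≤ ½`)

NE2 leaf prover 07, GEN 11 (`b2b-balaban-t4-ne2-formalise-leaf-07-g11`, numerics desk of sub-row Δ1), supplier brick «GW-V» for the row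
owner's GRADED WELL (R47 journal 2026-08-21 l.25022; objects `GradedSubBlocks` p244783 / `GradedWellData` p244847; offer l.25494; numerics:
memo `t4/T4-EST-NE2-D1-COLLAR.md` v1.1 §9.1b, job j114873 — `V = Q_GWᴴQ_GW − a·n^d·Q_⊤ᴴQ_⊤ ⪰ 0` to rounding for the typed `RowV`, FALSE for
the anchor-rule rows).

 * §9 `inv_pow_le_quarter`, **`coeff_one`** (`n^d·r₁^{−(d+1)}·r₁·w_lo^{−2} = L^{−2lo}`), **`coeff_two`** (`… = L^{−2hi}`);
   §10 **`unitRow_le_half_Tset`** (Jensen at scale `s_lo` — `GradedContourRefine.norm_sq_avgS_le` —, split of the level-1 family into typed rows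
   (fibres `≤ r₁` into `Tset`) and interior contours (Jensen again at `s_hi`, fibres `≤ r₁r′` into `Tset`), coefficients by §9).

HONEST FRAMING (T4-DAG p. 1).  [folklore] finite-torus combinatorics, Cauchy–Schwarz and bookkeeping on OUR model objects (U = 1, a
layer map on unit blocks, `m` fixed, finite torus); no estimate of Bałaban's is asserted, certified or disputed; NE2 (U1a) NOT proved; spine
PROVED 0/9 unchanged; NOT [B9] (3.16)/(3.23)–(3.27)/(3.42) as printed; NOT infinite volume / mass gap / Clay.  HONEST DEPENDENCY: continuum
YM on T⁴ ⇐ BetaPertH ∧ nine spine estimates (0/9 proved); BetaPertH ⇐ (D1) ∧ (D4) ∧ CAP+tail; G-an2-4 gates asym, D1 and NE2/3/4.  No `sorry`.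
-/

noncomputable section

open scoped BigOperators ComplexConjugate Matrix
open Finset

namespace Summit.QuantumFields.BalabanUV.T4Continuum.GradedWellUnitMass

open Literature.MathematicalPhysics.QuantumFieldTheory.Balaban1983to89.B5Prop11Plancherel (Tor fine unitVec)
open Literature.MathematicalPhysics.QuantumFieldTheory.Balaban1983to89.B5Prop11Lower (nsq nsq_nonneg)
open Literature.MathematicalPhysics.QuantumFieldTheory.Balaban1983to89.B5Block118 (tstep tstep_zero tstep_succ)
open Literature.MathematicalPhysics.QuantumFieldTheory.Balaban1983to89.B5Blocks16 (blockOf)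
open Literature.MathematicalPhysics.QuantumFieldTheory.Balaban1983to89.B5G183RateUnitTower (lev lev_neZero)
open Summit.QuantumFields.BalabanUV.T4Continuum
open Summit.QuantumFields.BalabanUV.T4Continuum.ScalarPlantingDefect (val_blockOf)
open Summit.QuantumFields.BalabanUV.T4Continuum.GradedSubBlocks (Anchor Anc InSub site meanS avgS avgS_mulVec s_pos site_add
  val_site anchor_add_tstep shiftAnc)
open Literature.MathematicalPhysics.QuantumFieldTheory.Balaban1983to89.B5Composition116 (tstep_add)
open Summit.QuantumFields.BalabanUV.T4Continuum.GradedContourRefine (subAnc subAnc_val mulOff mulOff_val norm_sq_avgS_le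
  anchor_of_dvd mul_lt_of_lt_div)
open Summit.QuantumFields.BalabanUV.T4Continuum.GradedWellData (sGW sGW_dvd wGW wGW_sq wGW_nonneg TorK RowV QvGW lev_eq_pow)
open Summit.QuantumFields.BalabanUV.T4Continuum.GradedWellSlice (sGW_dvd_lev sGW_dvd_sGW)

variable {d : ℕ}

section RowBound

variable (L : ℕ) [NeZero L] (M : Fin d → ℕ) [hM : ∀ μ, NeZero (M μ)] (k m : ℕ) (layer : Tor M → ℕ)

/-! ## §9 The coefficients `n^d/(r₁^d w_lo²) = L^{−2lo}` and `n^d/((r₁r′)^d w_hi²) = L^{−2hi}` -/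

omit [NeZero L] hM in
/-- `L^{−2i} ≤ 1/4` for `L ≥ 2`, `i ≥ 1`. [folklore] -/
theorem inv_pow_le_quarter (hL : 2 ≤ L) {i : ℕ} (hi : 1 ≤ i) : ((L : ℝ) ^ (2 * i))⁻¹ ≤ 1 / 4 := by
  have hL' : (2 : ℝ) ≤ L := by exact_mod_cast hL
  have h4 : (4 : ℝ) ≤ (L : ℝ) ^ (2 * i) := by
    calc (4 : ℝ) = 2 ^ 2 := by norm_num
      _ ≤ (L : ℝ) ^ 2 := by gcongr
      _ ≤ (L : ℝ) ^ (2 * i) := pow_le_pow_right₀ (by linarith) (by omega)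
  rw [inv_eq_one_div]
  exact one_div_le_one_div_of_le (by norm_num) h4

/-- the level-1 coefficient: `n^d·r₁^{−(d+1)}·r₁·w_lo^{−2} = L^{−2lo}`. [folklore] -/
theorem coeff_one (lo : ℕ) :
    ((lev L k : ℕ) : ℝ) ^ d * ((((lev L k / sGW L k lo : ℕ) : ℝ)) ^ (d + 1))⁻¹
        * ((((lev L k / sGW L k lo : ℕ) : ℝ)) * (wGW L k d lo ^ 2)⁻¹) = ((L : ℝ) ^ (2 * lo))⁻¹ := by
  have hn : ((sGW L k lo : ℕ) : ℝ) * (((lev L k / sGW L k lo : ℕ) : ℝ)) = ((lev L k : ℕ) : ℝ) := by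
    rw [← Nat.cast_mul, Nat.mul_div_cancel' (sGW_dvd_lev L k lo)]
  have hs0 : ((sGW L k lo : ℕ) : ℝ) ≠ 0 := by exact_mod_cast (sGW_pos L k lo).ne'
  have hr0 : (((lev L k / sGW L k lo : ℕ) : ℝ)) ≠ 0 := by
    exact_mod_cast (Nat.div_pos (Nat.le_of_dvd (lev_pos L k) (sGW_dvd_lev L k lo)) (sGW_pos L k lo)).ne'
  have hL0 : (L : ℝ) ≠ 0 := by exact_mod_cast NeZero.ne L
  rw [wGW_sq, ← hn]
  field_simp
  ring

/-- the level-2 coefficient: `n^d·r₁^{−(d+1)}·r′^{−(d+1)}·w_hi^{−2}·r₁r′ = L^{−2hi}`. [folklore] -/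
theorem coeff_two (lo hi : ℕ) (hlh : lo ≤ hi) :
    ((lev L k : ℕ) : ℝ) ^ d * ((((lev L k / sGW L k lo : ℕ) : ℝ)) ^ (d + 1))⁻¹
        * (((((sGW L k lo / sGW L k hi : ℕ) : ℝ)) ^ (d + 1))⁻¹ * ((wGW L k d hi ^ 2)⁻¹
          * ((((lev L k / sGW L k lo : ℕ) : ℝ)) * (((sGW L k lo / sGW L k hi : ℕ) : ℝ)))))
      = ((L : ℝ) ^ (2 * hi))⁻¹ := by
  have hn : ((sGW L k lo : ℕ) : ℝ) * (((lev L k / sGW L k lo : ℕ) : ℝ)) = ((lev L k : ℕ) : ℝ) := by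
    rw [← Nat.cast_mul, Nat.mul_div_cancel' (sGW_dvd_lev L k lo)]
  have hs : ((sGW L k hi : ℕ) : ℝ) * (((sGW L k lo / sGW L k hi : ℕ) : ℝ)) = ((sGW L k lo : ℕ) : ℝ) := by
    rw [← Nat.cast_mul, Nat.mul_div_cancel' (sGW_dvd_sGW L k hlh)]
  have hs0 : ((sGW L k hi : ℕ) : ℝ) ≠ 0 := by exact_mod_cast (sGW_pos L k hi).ne'
  have hr0 : (((lev L k / sGW L k lo : ℕ) : ℝ)) ≠ 0 := by
    exact_mod_cast (Nat.div_pos (Nat.le_of_dvd (lev_pos L k) (sGW_dvd_lev L k lo)) (sGW_pos L k lo)).ne'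
  have hr0' : (((sGW L k lo / sGW L k hi : ℕ) : ℝ)) ≠ 0 := by
    exact_mod_cast (Nat.div_pos (Nat.le_of_dvd (sGW_pos L k lo) (sGW_dvd_sGW L k hlh)) (sGW_pos L k hi)).ne'
  have hL0 : (L : ℝ) ≠ 0 := by exact_mod_cast NeZero.ne L
  rw [wGW_sq, ← hn, ← hs]
  field_simp
  ring

/-! ## §10 The per-unit-row bound (layers of both endpoint blocks `≥ 1`) -/

/-- **PER-UNIT-ROW BOUND**: if both endpoint blocks of the unit contour `(z, μ)` lie in layers `≥ 1` (`{layers} = {lo, hi}`),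
then `n^d·|(Q_n A)(z,μ)|² ≤ ½·Σ_{ω ∈ Tset} w²|(Q A)_ω|²` — two-level Jensen with coefficients `L^{−2lo} + L^{−2hi} ≤ ½`. [folklore] -/
theorem unitRow_le_half_Tset (hL : 2 ≤ L) (A : TorK L M k × Fin d → ℂ) (z : Anc (fine (lev L k) M) (lev L k)) (μ : Fin d)
    (lo hi : ℕ) (hlo1 : 1 ≤ lo) (hlh : lo ≤ hi) (hhi : hi < m + 1)
    (hB : (layer (blockOf (lev L k) M z.1) = lo ∧ layer (blockOf (lev L k) M z.1 + tstep M μ 1) = hi) ∨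
          (layer (blockOf (lev L k) M z.1) = hi ∧ layer (blockOf (lev L k) M z.1 + tstep M μ 1) = lo)) :
    ((lev L k : ℕ) : ℝ) ^ d * ‖(avgS (fine (lev L k) M) (lev L k) *ᵥ A) (z, μ)‖ ^ 2
      ≤ (1 / 2) * ∑ ω ∈ Tset L M k m layer z μ, Xfull L M k m A ω := by
  classical
  have hlo : lo < m + 1 := lt_of_le_of_lt hlh hhi
  have hhi1 : 1 ≤ hi := le_trans hlo1 hlh
  -- abbreviations
  set T := ∑ ω ∈ Tset L M k m layer z μ, Xfull L M k m A ω with hT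
  have hT0 : 0 ≤ T := Finset.sum_nonneg fun ω _ => Xfull_nonneg L M k m A ω
  set r₁ : ℕ := lev L k / sGW L k lo with hr₁
  set r' : ℕ := sGW L k lo / sGW L k hi with hr'
  set w₁ : ℝ := wGW L k d lo ^ 2 with hw₁
  set w₂ : ℝ := wGW L k d hi ^ 2 with hw₂
  have hw₁pos : 0 < w₁ := by
    rw [hw₁, wGW_sq]; exact mul_pos (pow_pos (by exact_mod_cast Nat.pos_of_ne_zero (NeZero.ne L)) _)
      (pow_pos (by exact_mod_cast sGW_pos L k lo) _)
  have hw₂pos : 0 < w₂ := by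
    rw [hw₂, wGW_sq]; exact mul_pos (pow_pos (by exact_mod_cast Nat.pos_of_ne_zero (NeZero.ne L)) _)
      (pow_pos (by exact_mod_cast sGW_pos L k hi) _)
  -- the two families of squared sub-contour averages
  set F : (Fin d → Fin r₁) × Fin r₁ → ℝ := fun x =>
    ‖(avgS (fine (lev L k) M) (sGW L k lo) *ᵥ A) (subOne L M k lo z μ x.1 x.2, μ)‖ ^ 2 with hF
  set G : ((Fin d → Fin r₁) × Fin r₁) × ((Fin d → Fin r') × Fin r') → ℝ := fun xy =>
    ‖(avgS (fine (lev L k) M) (sGW L k hi) *ᵥ A) (subTwo L M k hlh z μ xy.1.1 xy.1.2 xy.2.1 xy.2.2, μ)‖ ^ 2 with hG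
  have hF_X : ∀ x, F x = w₁⁻¹ * Xfull L M k m A (omega1 L M k m lo hlo z μ x) := by
    intro x; rw [Xfull_omega1, ← hw₁, ← mul_assoc, inv_mul_cancel₀ hw₁pos.ne', one_mul]
  have hG_X : ∀ xy, G xy = w₂⁻¹ * Xfull L M k m A (omega2 L M k m lo hi hlh hhi z μ xy) := by
    intro xy; rw [Xfull_omega2, ← hw₂, ← mul_assoc, inv_mul_cancel₀ hw₂pos.ne', one_mul]
  -- Jensen, level 1
  have J1 : ‖(avgS (fine (lev L k) M) (lev L k) *ᵥ A) (z, μ)‖ ^ 2 ≤ (((r₁ : ℕ) : ℝ) ^ (d + 1))⁻¹ * ∑ x, F x := by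
    have h := norm_sq_avgS_le (fine (lev L k) M) (lev L k) (sGW L k lo) (lev_dvd_fine L M k) (sGW_dvd L M k lo)
      (sGW_dvd_lev L k lo) A z μ
    rw [← Fintype.sum_prod_type'] at h
    exact h
  -- split the level-1 family into rows and interior contours
  set P : (Fin d → Fin r₁) × Fin r₁ → Prop := fun x => omega1 L M k m lo hlo z μ x ∈ rowSet L M k m layer with hP
  have hsplit : ∑ x, F x = ∑ x ∈ Finset.univ.filter P, F x + ∑ x ∈ Finset.univ.filter (fun x => ¬ P x), F x :=
    (Finset.sum_filter_add_sum_filter_not _ P F).symm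
  -- rows: fibre counting into Tset
  have hR : ∑ x ∈ Finset.univ.filter P, F x ≤ w₁⁻¹ * ((r₁ : ℝ) * T) := by
    rw [Finset.sum_congr rfl (fun x _ => hF_X x), ← Finset.mul_sum]
    refine mul_le_mul_of_nonneg_left ?_ (le_of_lt (inv_pos.mpr hw₁pos))
    exact sum_le_card_mul_sum_of_fibre _ _ (omega1 L M k m lo hlo z μ)
      (fun x hx => omega1_mem_Tset L M k m layer lo hlo hlo1 z μ x (Finset.mem_filter.mp hx).2)
      (Xfull L M k m A) (fun ω _ => Xfull_nonneg L M k m A ω) r₁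
      (fun ω _ => card_fibre_omega1 L M k m lo hlo z μ _ ω)
  -- interior contours: Jensen level 2, then fibre counting into Tset
  have hI : ∑ x ∈ Finset.univ.filter (fun x => ¬ P x), F x
      ≤ (((r' : ℕ) : ℝ) ^ (d + 1))⁻¹ * (w₂⁻¹ * (((r₁ : ℕ) : ℝ) * r' * T)) := by
    have J2 : ∀ x, F x ≤ (((r' : ℕ) : ℝ) ^ (d + 1))⁻¹ * ∑ y, G (x, y) := by
      intro x
      have h := norm_sq_avgS_le (fine (lev L k) M) (sGW L k lo) (sGW L k hi) (sGW_dvd L M k lo) (sGW_dvd L M k hi)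
        (sGW_dvd_sGW L k hlh) A (subOne L M k lo z μ x.1 x.2) μ
      rw [← Fintype.sum_prod_type'] at h
      exact h
    calc ∑ x ∈ Finset.univ.filter (fun x => ¬ P x), F x
        ≤ ∑ x ∈ Finset.univ.filter (fun x => ¬ P x), (((r' : ℕ) : ℝ) ^ (d + 1))⁻¹ * ∑ y, G (x, y) :=
          Finset.sum_le_sum fun x _ => J2 x
      _ = (((r' : ℕ) : ℝ) ^ (d + 1))⁻¹ * ∑ xy ∈ (Finset.univ.filter (fun x => ¬ P x)) ×ˢ Finset.univ, G xy := by
          rw [← Finset.mul_sum, Finset.sum_product]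
      _ = (((r' : ℕ) : ℝ) ^ (d + 1))⁻¹ * (w₂⁻¹ * ∑ xy ∈ (Finset.univ.filter (fun x => ¬ P x)) ×ˢ Finset.univ,
            Xfull L M k m A (omega2 L M k m lo hi hlh hhi z μ xy)) := by
          rw [Finset.sum_congr rfl (fun xy _ => hG_X xy), ← Finset.mul_sum]
      _ ≤ (((r' : ℕ) : ℝ) ^ (d + 1))⁻¹ * (w₂⁻¹ * (((r₁ : ℕ) : ℝ) * r' * T)) := by
          refine mul_le_mul_of_nonneg_left (mul_le_mul_of_nonneg_left ?_ (le_of_lt (inv_pos.mpr hw₂pos))) (by positivity)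
          have h := sum_le_card_mul_sum_of_fibre ((Finset.univ.filter (fun x => ¬ P x)) ×ˢ Finset.univ)
            (Tset L M k m layer z μ) (omega2 L M k m lo hi hlh hhi z μ)
            (fun xy hxy => by
              obtain ⟨hx, _⟩ := Finset.mem_product.mp hxy
              have hx' := (Finset.mem_filter.mp hx).2
              exact omega2_mem_Tset L M k m layer lo hi hlh hhi hhi1 z μ hB xy.1 hx' xy.2)
            (Xfull L M k m A) (fun ω _ => Xfull_nonneg L M k m A ω) (r₁ * r')
            (fun ω _ => card_fibre_omega2 L M k m lo hi hlh hhi z μ _ ω)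
          rw [Nat.cast_mul] at h
          exact h
  -- assemble
  have hn0 : (0 : ℝ) ≤ ((lev L k : ℕ) : ℝ) ^ d := by positivity
  calc ((lev L k : ℕ) : ℝ) ^ d * ‖(avgS (fine (lev L k) M) (lev L k) *ᵥ A) (z, μ)‖ ^ 2
      ≤ ((lev L k : ℕ) : ℝ) ^ d * ((((r₁ : ℕ) : ℝ) ^ (d + 1))⁻¹
          * (w₁⁻¹ * ((r₁ : ℝ) * T) + (((r' : ℕ) : ℝ) ^ (d + 1))⁻¹ * (w₂⁻¹ * (((r₁ : ℕ) : ℝ) * r' * T)))) := by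
        refine mul_le_mul_of_nonneg_left (J1.trans ?_) hn0
        rw [hsplit]
        exact mul_le_mul_of_nonneg_left (add_le_add hR hI) (by positivity)
    _ = (((lev L k : ℕ) : ℝ) ^ d * ((((r₁ : ℕ) : ℝ)) ^ (d + 1))⁻¹ * ((((r₁ : ℕ) : ℝ)) * w₁⁻¹)
          + ((lev L k : ℕ) : ℝ) ^ d * ((((r₁ : ℕ) : ℝ)) ^ (d + 1))⁻¹
              * (((((r' : ℕ) : ℝ)) ^ (d + 1))⁻¹ * (w₂⁻¹ * ((((r₁ : ℕ) : ℝ)) * (((r' : ℕ) : ℝ)))))) * T := by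
        ring
    _ = (((L : ℝ) ^ (2 * lo))⁻¹ + ((L : ℝ) ^ (2 * hi))⁻¹) * T := by
        rw [hw₁, hw₂, hr₁, hr', coeff_one L k lo, coeff_two L k lo hi hlh]
    _ ≤ (1 / 4 + 1 / 4) * T := by
        exact mul_le_mul_of_nonneg_right (add_le_add (inv_pow_le_quarter L hL hlo1) (inv_pow_le_quarter L hL hhi1)) hT0
    _ = (1 / 2) * T := by norm_num

end RowBound

end Summit.QuantumFields.BalabanUV.T4Continuum.GradedWellUnitMass

end
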